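import Summits.KontsevichZagierPeriods.Zeta5Search.Certificates.RecordRayDenominatorsCellsC
import Summits.KontsevichZagierPeriods.Zeta5Search.Certificates.RecordRayDenominatorsLawWWindows
import Summits.KontsevichZagierPeriods.Zeta5Search.AtlasCellRecB
import Summits.KontsevichZagierPeriods.Zeta5Search.RecordCellAProof
import Summits.KontsevichZagierPeriods.Zeta5Search.RecordCellCProof
import Summits.KontsevichZagierPeriods.Zeta5Search.RecordCellDProof
import HarnessLib

/-!
# ζ(5) search — the record ray's DENOMINATORS, X-a: the 27-window tables and seven more window lemmas (TYPER g15)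

HONEST FRAMING: systematic search; no irrationality claim unless certified.

OUR work (Summit side; typer seat, generation 15).  Tables `AZy, BZy, wQy : Fin 27 → ℕ` (endpoints × 4680, exponents) of the
27-window atlas of file X-b: the 20 windows of file VII (tables of file VI-a), then
`(12n, 25n/2]⁹` (PROVED record cell B, `AtlasCellRecB.holds`: `v_p(Cas₇) ≥ −6`), `(25n/2, 13n]¹`, `(13n, 14n]¹` (file VIII-b),
`(14n, 15n]³` (PROVED record cell A, `CellA.recordCellA`: `≥ −4`), `(15n, 16n]³` (file VIII-b), `(17n/2, 9n]⁵` (cell C,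
`CellC.recordCellC`: `≥ −12`), `(7n, 15n/2]³` (cell D, `CellD.recordCellD`: `≥ −12`) — the cell windows through `cell_core`
(file V) exactly as in files VI-a/b/c, the `(WV)`-law windows as wrappers of `wLaw0/1/3`.  Rate `Σ k_i(B_i − A_i) = 414253 / 1560`.
Valuation bookkeeping only.
-/

noncomputable section

open Finset Real Filter Topology

namespace Summit.KontsevichZagierPeriods.Zeta5Search.RecordRay

open Summit.KontsevichZagierPeriods.Zeta5Search.DualSeries
open Summit.KontsevichZagierPeriods.Zeta5Search.DualSeriesDenominators
open Summit.KontsevichZagierPeriods.Zeta5Search.WedgeDictionary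
open Summit.KontsevichZagierPeriods.Zeta5Search.DualSeriesLemma19 (bRecord)
open Summit.KontsevichZagierPeriods.Zeta5Search.CasoratianValuation (casoratian shift)

/-- Left endpoints of the 27 windows, times `4680` (integers; window `i` is `(AZy i/4680 · n, BZy i/4680 · n]`). -/
def AZy : Fin 27 → ℕ := ![74880, 79560, 84240, 117000, 8840, 9360, 14040, 18720, 19188, 19500, 21060, 21840, 23400, 25740, 26520, 28080, 29250, 37440, 38376, 39000, 56160, 65520, 39780, 32760, 58500, 60840, 70200]

/-- Right endpoints of the 27 windows, times `4680`. -/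
def BZy : Fin 27 → ℕ := ![79560, 84240, 117000, 191880, 9000, 9750, 14625, 19188, 19500, 19890, 21840, 23400, 24960, 26520, 28080, 29250, 29640, 38376, 39000, 39780, 58500, 70200, 42120, 35100, 60840, 65520, 74880]

/-- Exponents removed on the 27 windows. -/
def wQy : Fin 27 → ℕ := ![8, 9, 10, 9, 6, 7, 7, 9, 8, 8, 7, 4, 5, 9, 9, 9, 8, 7, 6, 6, 9, 3, 5, 3, 1, 1, 3]

/-- Left endpoints as reals. -/
def AwinY (i : Fin 27) : ℝ := (AZy i : ℝ) / 4680

/-- Right endpoints as reals. -/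
def BwinY (i : Fin 27) : ℝ := (BZy i : ℝ) / 4680

section Windows

variable {n p : ℕ}

/-- Cell window `(12n, 25/2n]`: `AtlasCellRecB.holds` (`-6 ≤ v_p(Cas₇)`, PROVED), `v_p(N♯) = 3`, `v_p(ρ) = 2`, exponent `9`. -/
theorem wCellY0 {n p : ℕ} (hn : 42 ≤ n) (hp : p.Prime) (hlo : AwinY 20 * n < p) (hhi : (p : ℝ) ≤ BwinY 20 * n)
    {zW zV zW' zV' zU zU' : ℤ}
    (hzW : dRec n ^ 3 * sharpNormaliser (bRecord n) * coeffW (bRecord n) = zW)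
    (hzV : dRec n ^ 6 * sharpNormaliser (bRecord n) * coeffV (bRecord n) = zV)
    (hzW' : dRec n ^ 3 * sharpNormaliser (bRecord' n) * coeffW (bRecord' n) = zW')
    (hzV' : dRec n ^ 6 * sharpNormaliser (bRecord' n) * coeffV (bRecord' n) = zV')
    (hzU : dRec n * sharpNormaliser (bRecord n) * coeffU (bRecord n) = zU)
    (hzU' : dRec n * sharpNormaliser (bRecord' n) * coeffU (bRecord' n) = zU') :
    (p : ℤ) ^ 9 ∣ (zW' * zV - zW * zV') ∧
    (p : ℤ) ^ 9 ∣ ((Nat.lcmUpto (41 * n) : ℤ) ^ 5 * (zU * zW') - (Nat.lcmUpto (41 * n) : ℤ) ^ 5 * (zU' * zW)) := by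
  have hloN : 12 * n < 1 * p := by
    have h : ((AZy 20 : ℕ) : ℝ) / 4680 * n < p := hlo
    rw [show AZy 20 = 56160 by decide] at h
    have h' : ((12 : ℕ) : ℝ) * n < ((1 : ℕ) : ℝ) * p := by push_cast at h ⊢; linarith
    exact_mod_cast h'
  have hhiN : 2 * p ≤ 25 * n := by
    have h : (p : ℝ) ≤ ((BZy 20 : ℕ) : ℝ) / 4680 * n := hhi
    rw [show BZy 20 = 58500 by decide] at h
    have h' : ((2 : ℕ) : ℝ) * p ≤ ((25 : ℕ) : ℝ) * n := by push_cast at h ⊢; linarith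
    exact_mod_cast h'
  have hhiN' : 2 * p ≤ 25 * n := hhiN
  have hn1 : 1 ≤ n := by omega
  have hnp : n < p := by omega
  have hp41 : p ≤ 41 * n := by omega
  have hsq : 41 * n < p ^ 2 := by nlinarith
  have e8 : 8 * n / p = 0 := Nat.div_eq_of_lt_le (by omega) (by omega)
  have e9 : 9 * n / p = 0 := Nat.div_eq_of_lt_le (by omega) (by omega)
  have e10 : 10 * n / p = 0 := Nat.div_eq_of_lt_le (by omega) (by omega)
  have e11 : 11 * n / p = 0 := Nat.div_eq_of_lt_le (by omega) (by omega)
  have e12 : 12 * n / p = 0 := Nat.div_eq_of_lt_le (by omega) (by omega)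
  have e13 : 13 * n / p = 1 := Nat.div_eq_of_lt_le (by omega) (by omega)
  have e14 : 14 * n / p = 1 := Nat.div_eq_of_lt_le (by omega) (by omega)
  have e15 : 15 * n / p = 1 := Nat.div_eq_of_lt_le (by omega) (by omega)
  have e16 : 16 * n / p = 1 := Nat.div_eq_of_lt_le (by omega) (by omega)
  have e17 : 17 * n / p = 1 := Nat.div_eq_of_lt_le (by omega) (by omega)
  have e18 : 18 * n / p = 1 := Nat.div_eq_of_lt_le (by omega) (by omega)
  have e25 : 25 * n / p = 2 := Nat.div_eq_of_lt_le (by omega) (by omega)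
  have hvN : padicValRat p (sharpNormaliser (bRecord n)) = 3 := by
    rw [padicValRat_sharpNormaliser_bRecord hp (by omega), e12, e13, e14, e15, e16]; norm_num
  have hvN' : padicValRat p (sharpNormaliser (bRecord' n)) = 3 := by
    rw [padicValRat_sharpNormaliser_bRecord' hn1 hp hnp (by omega) (by omega), e12, e13, e14, e15, e16]; norm_num
  have hvr : padicValRat p (rhoOf (aRec n)) = 2 := by
    rw [padicValRat_rhoOf_aRec hp (by omega) (by omega), e8, e9, e10, e11, e12, e13, e14, e15, e16, e17, e18, e25]
    norm_num
  have hcas : casoratian (bRecord n) 7 ≠ 0 → (-6 : ℤ) ≤ padicValRat p (casoratian (bRecord n) 7) := by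
    intro hne
    rw [bRecord_eq_bRec] at hne ⊢
    exact AtlasCellRecB.holds n p (by omega) hp (by omega) (by have := lt_mul_of_prime hp hnp (show 25 < p by omega) (by norm_num) hn1 hhiN'; omega) hne
  exact cell_core hn1 hp hp41 hsq hvN hvN' hvr hcas (k := 9) (by norm_num) (by norm_num) hzW hzV hzW' hzV' hzU hzU'

/-- Cell window `(14n, 15n]`: `CellA.recordCellA` (`-4 ≤ v_p(Cas₇)`, PROVED), `v_p(N♯) = -1`, `v_p(ρ) = 3`, exponent `3`. -/
theorem wCellY1 {n p : ℕ} (hn : 42 ≤ n) (hp : p.Prime) (hlo : AwinY 21 * n < p) (hhi : (p : ℝ) ≤ BwinY 21 * n)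
    {zW zV zW' zV' zU zU' : ℤ}
    (hzW : dRec n ^ 3 * sharpNormaliser (bRecord n) * coeffW (bRecord n) = zW)
    (hzV : dRec n ^ 6 * sharpNormaliser (bRecord n) * coeffV (bRecord n) = zV)
    (hzW' : dRec n ^ 3 * sharpNormaliser (bRecord' n) * coeffW (bRecord' n) = zW')
    (hzV' : dRec n ^ 6 * sharpNormaliser (bRecord' n) * coeffV (bRecord' n) = zV')
    (hzU : dRec n * sharpNormaliser (bRecord n) * coeffU (bRecord n) = zU)
    (hzU' : dRec n * sharpNormaliser (bRecord' n) * coeffU (bRecord' n) = zU') :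
    (p : ℤ) ^ 3 ∣ (zW' * zV - zW * zV') ∧
    (p : ℤ) ^ 3 ∣ ((Nat.lcmUpto (41 * n) : ℤ) ^ 5 * (zU * zW') - (Nat.lcmUpto (41 * n) : ℤ) ^ 5 * (zU' * zW)) := by
  have hloN : 14 * n < 1 * p := by
    have h : ((AZy 21 : ℕ) : ℝ) / 4680 * n < p := hlo
    rw [show AZy 21 = 65520 by decide] at h
    have h' : ((14 : ℕ) : ℝ) * n < ((1 : ℕ) : ℝ) * p := by push_cast at h ⊢; linarith
    exact_mod_cast h'
  have hhiN : 1 * p ≤ 15 * n := by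
    have h : (p : ℝ) ≤ ((BZy 21 : ℕ) : ℝ) / 4680 * n := hhi
    rw [show BZy 21 = 70200 by decide] at h
    have h' : ((1 : ℕ) : ℝ) * p ≤ ((15 : ℕ) : ℝ) * n := by push_cast at h ⊢; linarith
    exact_mod_cast h'
  have hhiN' : 1 * p ≤ 15 * n := hhiN
  have hn1 : 1 ≤ n := by omega
  have hnp : n < p := by omega
  have hp41 : p ≤ 41 * n := by omega
  have hsq : 41 * n < p ^ 2 := by nlinarith
  have e8 : 8 * n / p = 0 := Nat.div_eq_of_lt_le (by omega) (by omega)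
  have e9 : 9 * n / p = 0 := Nat.div_eq_of_lt_le (by omega) (by omega)
  have e10 : 10 * n / p = 0 := Nat.div_eq_of_lt_le (by omega) (by omega)
  have e11 : 11 * n / p = 0 := Nat.div_eq_of_lt_le (by omega) (by omega)
  have e12 : 12 * n / p = 0 := Nat.div_eq_of_lt_le (by omega) (by omega)
  have e13 : 13 * n / p = 0 := Nat.div_eq_of_lt_le (by omega) (by omega)
  have e14 : 14 * n / p = 0 := Nat.div_eq_of_lt_le (by omega) (by omega)
  have e15 : 15 * n / p = 1 := Nat.div_eq_of_lt_le (by omega) (by omega)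
  have e16 : 16 * n / p = 1 := Nat.div_eq_of_lt_le (by omega) (by omega)
  have e17 : 17 * n / p = 1 := Nat.div_eq_of_lt_le (by omega) (by omega)
  have e18 : 18 * n / p = 1 := Nat.div_eq_of_lt_le (by omega) (by omega)
  have e25 : 25 * n / p = 1 := Nat.div_eq_of_lt_le (by omega) (by omega)
  have hvN : padicValRat p (sharpNormaliser (bRecord n)) = -1 := by
    rw [padicValRat_sharpNormaliser_bRecord hp (by omega), e12, e13, e14, e15, e16]; norm_num
  have hvN' : padicValRat p (sharpNormaliser (bRecord' n)) = -1 := by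
    rw [padicValRat_sharpNormaliser_bRecord' hn1 hp hnp (by omega) (by omega), e12, e13, e14, e15, e16]; norm_num
  have hvr : padicValRat p (rhoOf (aRec n)) = 3 := by
    rw [padicValRat_rhoOf_aRec hp (by omega) (by omega), e8, e9, e10, e11, e12, e13, e14, e15, e16, e17, e18, e25]
    norm_num
  have hcas : casoratian (bRecord n) 7 ≠ 0 → (-4 : ℤ) ≤ padicValRat p (casoratian (bRecord n) 7) := by
    intro hne
    rw [bRecord_eq_bRec] at hne ⊢
    exact CellA.recordCellA n p (by omega) hp (by omega) (by have := lt_mul_of_prime hp hnp (show 15 < p by omega) (by norm_num) hn1 hhiN'; omega) hne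
  exact cell_core hn1 hp hp41 hsq hvN hvN' hvr hcas (k := 3) (by norm_num) (by norm_num) hzW hzV hzW' hzV' hzU hzU'

/-- Cell window `(17/2n, 9n]`: `CellC.recordCellC` (`-12 ≤ v_p(Cas₇)`, PROVED), `v_p(N♯) = 4`, `v_p(ρ) = 8`, exponent `5`. -/
theorem wCellY2 {n p : ℕ} (hn : 42 ≤ n) (hp : p.Prime) (hlo : AwinY 22 * n < p) (hhi : (p : ℝ) ≤ BwinY 22 * n)
    {zW zV zW' zV' zU zU' : ℤ}
    (hzW : dRec n ^ 3 * sharpNormaliser (bRecord n) * coeffW (bRecord n) = zW)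
    (hzV : dRec n ^ 6 * sharpNormaliser (bRecord n) * coeffV (bRecord n) = zV)
    (hzW' : dRec n ^ 3 * sharpNormaliser (bRecord' n) * coeffW (bRecord' n) = zW')
    (hzV' : dRec n ^ 6 * sharpNormaliser (bRecord' n) * coeffV (bRecord' n) = zV')
    (hzU : dRec n * sharpNormaliser (bRecord n) * coeffU (bRecord n) = zU)
    (hzU' : dRec n * sharpNormaliser (bRecord' n) * coeffU (bRecord' n) = zU') :
    (p : ℤ) ^ 5 ∣ (zW' * zV - zW * zV') ∧
    (p : ℤ) ^ 5 ∣ ((Nat.lcmUpto (41 * n) : ℤ) ^ 5 * (zU * zW') - (Nat.lcmUpto (41 * n) : ℤ) ^ 5 * (zU' * zW)) := by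
  have hloN : 17 * n < 2 * p := by
    have h : ((AZy 22 : ℕ) : ℝ) / 4680 * n < p := hlo
    rw [show AZy 22 = 39780 by decide] at h
    have h' : ((17 : ℕ) : ℝ) * n < ((2 : ℕ) : ℝ) * p := by push_cast at h ⊢; linarith
    exact_mod_cast h'
  have hhiN : 1 * p ≤ 9 * n := by
    have h : (p : ℝ) ≤ ((BZy 22 : ℕ) : ℝ) / 4680 * n := hhi
    rw [show BZy 22 = 42120 by decide] at h
    have h' : ((1 : ℕ) : ℝ) * p ≤ ((9 : ℕ) : ℝ) * n := by push_cast at h ⊢; linarith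
    exact_mod_cast h'
  have hhiN' : 1 * p ≤ 9 * n := hhiN
  have hn1 : 1 ≤ n := by omega
  have hnp : n < p := by omega
  have hp41 : p ≤ 41 * n := by omega
  have hsq : 41 * n < p ^ 2 := by nlinarith
  have e8 : 8 * n / p = 0 := Nat.div_eq_of_lt_le (by omega) (by omega)
  have e9 : 9 * n / p = 1 := Nat.div_eq_of_lt_le (by omega) (by omega)
  have e10 : 10 * n / p = 1 := Nat.div_eq_of_lt_le (by omega) (by omega)
  have e11 : 11 * n / p = 1 := Nat.div_eq_of_lt_le (by omega) (by omega)
  have e12 : 12 * n / p = 1 := Nat.div_eq_of_lt_le (by omega) (by omega)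
  have e13 : 13 * n / p = 1 := Nat.div_eq_of_lt_le (by omega) (by omega)
  have e14 : 14 * n / p = 1 := Nat.div_eq_of_lt_le (by omega) (by omega)
  have e15 : 15 * n / p = 1 := Nat.div_eq_of_lt_le (by omega) (by omega)
  have e16 : 16 * n / p = 1 := Nat.div_eq_of_lt_le (by omega) (by omega)
  have e17 : 17 * n / p = 1 := Nat.div_eq_of_lt_le (by omega) (by omega)
  have e18 : 18 * n / p = 2 := Nat.div_eq_of_lt_le (by omega) (by omega)
  have e25 : 25 * n / p = 2 := Nat.div_eq_of_lt_le (by omega) (by omega)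
  have hvN : padicValRat p (sharpNormaliser (bRecord n)) = 4 := by
    rw [padicValRat_sharpNormaliser_bRecord hp (by omega), e12, e13, e14, e15, e16]; norm_num
  have hvN' : padicValRat p (sharpNormaliser (bRecord' n)) = 4 := by
    rw [padicValRat_sharpNormaliser_bRecord' hn1 hp hnp (by omega) (by omega), e12, e13, e14, e15, e16]; norm_num
  have hvr : padicValRat p (rhoOf (aRec n)) = 8 := by
    rw [padicValRat_rhoOf_aRec hp (by omega) (by omega), e8, e9, e10, e11, e12, e13, e14, e15, e16, e17, e18, e25]
    norm_num
  have hcas : casoratian (bRecord n) 7 ≠ 0 → (-12 : ℤ) ≤ padicValRat p (casoratian (bRecord n) 7) := by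
    intro hne
    rw [bRecord_eq_bRec] at hne ⊢
    exact CellC.recordCellC n p (by omega) hp (by omega) (by have := lt_mul_of_prime hp hnp (show 9 < p by omega) (by norm_num) hn1 hhiN'; omega) hne
  exact cell_core hn1 hp hp41 hsq hvN hvN' hvr hcas (k := 5) (by norm_num) (by norm_num) hzW hzV hzW' hzV' hzU hzU'

/-- Cell window `(7n, 15/2n]`: `CellD.recordCellD` (`-12 ≤ v_p(Cas₇)`, PROVED), `v_p(N♯) = 3`, `v_p(ρ) = 11`, exponent `3`. -/
theorem wCellY3 {n p : ℕ} (hn : 42 ≤ n) (hp : p.Prime) (hlo : AwinY 23 * n < p) (hhi : (p : ℝ) ≤ BwinY 23 * n)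
    {zW zV zW' zV' zU zU' : ℤ}
    (hzW : dRec n ^ 3 * sharpNormaliser (bRecord n) * coeffW (bRecord n) = zW)
    (hzV : dRec n ^ 6 * sharpNormaliser (bRecord n) * coeffV (bRecord n) = zV)
    (hzW' : dRec n ^ 3 * sharpNormaliser (bRecord' n) * coeffW (bRecord' n) = zW')
    (hzV' : dRec n ^ 6 * sharpNormaliser (bRecord' n) * coeffV (bRecord' n) = zV')
    (hzU : dRec n * sharpNormaliser (bRecord n) * coeffU (bRecord n) = zU)
    (hzU' : dRec n * sharpNormaliser (bRecord' n) * coeffU (bRecord' n) = zU') :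
    (p : ℤ) ^ 3 ∣ (zW' * zV - zW * zV') ∧
    (p : ℤ) ^ 3 ∣ ((Nat.lcmUpto (41 * n) : ℤ) ^ 5 * (zU * zW') - (Nat.lcmUpto (41 * n) : ℤ) ^ 5 * (zU' * zW)) := by
  have hloN : 7 * n < 1 * p := by
    have h : ((AZy 23 : ℕ) : ℝ) / 4680 * n < p := hlo
    rw [show AZy 23 = 32760 by decide] at h
    have h' : ((7 : ℕ) : ℝ) * n < ((1 : ℕ) : ℝ) * p := by push_cast at h ⊢; linarith
    exact_mod_cast h'
  have hhiN : 2 * p ≤ 15 * n := by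
    have h : (p : ℝ) ≤ ((BZy 23 : ℕ) : ℝ) / 4680 * n := hhi
    rw [show BZy 23 = 35100 by decide] at h
    have h' : ((2 : ℕ) : ℝ) * p ≤ ((15 : ℕ) : ℝ) * n := by push_cast at h ⊢; linarith
    exact_mod_cast h'
  have hhiN' : 2 * p ≤ 15 * n := hhiN
  have hn1 : 1 ≤ n := by omega
  have hnp : n < p := by omega
  have hp41 : p ≤ 41 * n := by omega
  have hsq : 41 * n < p ^ 2 := by nlinarith
  have e8 : 8 * n / p = 1 := Nat.div_eq_of_lt_le (by omega) (by omega)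
  have e9 : 9 * n / p = 1 := Nat.div_eq_of_lt_le (by omega) (by omega)
  have e10 : 10 * n / p = 1 := Nat.div_eq_of_lt_le (by omega) (by omega)
  have e11 : 11 * n / p = 1 := Nat.div_eq_of_lt_le (by omega) (by omega)
  have e12 : 12 * n / p = 1 := Nat.div_eq_of_lt_le (by omega) (by omega)
  have e13 : 13 * n / p = 1 := Nat.div_eq_of_lt_le (by omega) (by omega)
  have e14 : 14 * n / p = 1 := Nat.div_eq_of_lt_le (by omega) (by omega)
  have e15 : 15 * n / p = 2 := Nat.div_eq_of_lt_le (by omega) (by omega)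
  have e16 : 16 * n / p = 2 := Nat.div_eq_of_lt_le (by omega) (by omega)
  have e17 : 17 * n / p = 2 := Nat.div_eq_of_lt_le (by omega) (by omega)
  have e18 : 18 * n / p = 2 := Nat.div_eq_of_lt_le (by omega) (by omega)
  have e25 : 25 * n / p = 3 := Nat.div_eq_of_lt_le (by omega) (by omega)
  have hvN : padicValRat p (sharpNormaliser (bRecord n)) = 3 := by
    rw [padicValRat_sharpNormaliser_bRecord hp (by omega), e12, e13, e14, e15, e16]; norm_num
  have hvN' : padicValRat p (sharpNormaliser (bRecord' n)) = 3 := by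
    rw [padicValRat_sharpNormaliser_bRecord' hn1 hp hnp (by omega) (by omega), e12, e13, e14, e15, e16]; norm_num
  have hvr : padicValRat p (rhoOf (aRec n)) = 11 := by
    rw [padicValRat_rhoOf_aRec hp (by omega) (by omega), e8, e9, e10, e11, e12, e13, e14, e15, e16, e17, e18, e25]
    norm_num
  have hcas : casoratian (bRecord n) 7 ≠ 0 → (-12 : ℤ) ≤ padicValRat p (casoratian (bRecord n) 7) := by
    intro hne
    rw [bRecord_eq_bRec] at hne ⊢
    exact CellD.recordCellD n p (by omega) hp (by omega) (by have := lt_mul_of_prime hp hnp (show 15 < p by omega) (by norm_num) hn1 hhiN'; omega) hne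
  exact cell_core hn1 hp hp41 hsq hvN hvN' hvr hcas (k := 3) (by norm_num) (by norm_num) hzW hzV hzW' hzV' hzU hzU'

/-- `(WV)`-law window `(25/2n, 13n]` (file VIII-b `wLaw0`), exponent `1`. -/
theorem wLawY0 {n p : ℕ} (hn : 42 ≤ n) (hp : p.Prime) (hlo : AwinY 24 * n < p) (hhi : (p : ℝ) ≤ BwinY 24 * n)
    {zW zV zW' zV' zU zU' : ℤ}
    (hzW : dRec n ^ 3 * sharpNormaliser (bRecord n) * coeffW (bRecord n) = zW)
    (hzV : dRec n ^ 6 * sharpNormaliser (bRecord n) * coeffV (bRecord n) = zV)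
    (hzW' : dRec n ^ 3 * sharpNormaliser (bRecord' n) * coeffW (bRecord' n) = zW')
    (hzV' : dRec n ^ 6 * sharpNormaliser (bRecord' n) * coeffV (bRecord' n) = zV')
    (hzU : dRec n * sharpNormaliser (bRecord n) * coeffU (bRecord n) = zU)
    (hzU' : dRec n * sharpNormaliser (bRecord' n) * coeffU (bRecord' n) = zU') :
    (p : ℤ) ^ 1 ∣ (zW' * zV - zW * zV') ∧
    (p : ℤ) ^ 1 ∣ ((Nat.lcmUpto (41 * n) : ℤ) ^ 5 * (zU * zW') - (Nat.lcmUpto (41 * n) : ℤ) ^ 5 * (zU' * zW)) := by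
  have hloN : 25 * n < 2 * p := by
    have h : ((AZy 24 : ℕ) : ℝ) / 4680 * n < p := hlo
    rw [show AZy 24 = 58500 by decide] at h
    have h' : ((25 : ℕ) : ℝ) * n < ((2 : ℕ) : ℝ) * p := by push_cast at h ⊢; linarith
    exact_mod_cast h'
  have hhiN : 1 * p ≤ 13 * n := by
    have h : (p : ℝ) ≤ ((BZy 24 : ℕ) : ℝ) / 4680 * n := hhi
    rw [show BZy 24 = 60840 by decide] at h
    have h' : ((1 : ℕ) : ℝ) * p ≤ ((13 : ℕ) : ℝ) * n := by push_cast at h ⊢; linarith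
    exact_mod_cast h'
  exact wLaw0 hn hp (by omega) (by omega) hzW hzV hzW' hzV' hzU hzU'

/-- `(WV)`-law window `(13n, 14n]` (file VIII-b `wLaw1`), exponent `1`. -/
theorem wLawY1 {n p : ℕ} (hn : 42 ≤ n) (hp : p.Prime) (hlo : AwinY 25 * n < p) (hhi : (p : ℝ) ≤ BwinY 25 * n)
    {zW zV zW' zV' zU zU' : ℤ}
    (hzW : dRec n ^ 3 * sharpNormaliser (bRecord n) * coeffW (bRecord n) = zW)
    (hzV : dRec n ^ 6 * sharpNormaliser (bRecord n) * coeffV (bRecord n) = zV)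
    (hzW' : dRec n ^ 3 * sharpNormaliser (bRecord' n) * coeffW (bRecord' n) = zW')
    (hzV' : dRec n ^ 6 * sharpNormaliser (bRecord' n) * coeffV (bRecord' n) = zV')
    (hzU : dRec n * sharpNormaliser (bRecord n) * coeffU (bRecord n) = zU)
    (hzU' : dRec n * sharpNormaliser (bRecord' n) * coeffU (bRecord' n) = zU') :
    (p : ℤ) ^ 1 ∣ (zW' * zV - zW * zV') ∧
    (p : ℤ) ^ 1 ∣ ((Nat.lcmUpto (41 * n) : ℤ) ^ 5 * (zU * zW') - (Nat.lcmUpto (41 * n) : ℤ) ^ 5 * (zU' * zW)) := by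
  have hloN : 13 * n < 1 * p := by
    have h : ((AZy 25 : ℕ) : ℝ) / 4680 * n < p := hlo
    rw [show AZy 25 = 60840 by decide] at h
    have h' : ((13 : ℕ) : ℝ) * n < ((1 : ℕ) : ℝ) * p := by push_cast at h ⊢; linarith
    exact_mod_cast h'
  have hhiN : 1 * p ≤ 14 * n := by
    have h : (p : ℝ) ≤ ((BZy 25 : ℕ) : ℝ) / 4680 * n := hhi
    rw [show BZy 25 = 65520 by decide] at h
    have h' : ((1 : ℕ) : ℝ) * p ≤ ((14 : ℕ) : ℝ) * n := by push_cast at h ⊢; linarith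
    exact_mod_cast h'
  exact wLaw1 hn hp (by omega) (by omega) hzW hzV hzW' hzV' hzU hzU'

/-- `(WV)`-law window `(15n, 16n]` (file VIII-b `wLaw3`), exponent `3`. -/
theorem wLawY2 {n p : ℕ} (hn : 42 ≤ n) (hp : p.Prime) (hlo : AwinY 26 * n < p) (hhi : (p : ℝ) ≤ BwinY 26 * n)
    {zW zV zW' zV' zU zU' : ℤ}
    (hzW : dRec n ^ 3 * sharpNormaliser (bRecord n) * coeffW (bRecord n) = zW)
    (hzV : dRec n ^ 6 * sharpNormaliser (bRecord n) * coeffV (bRecord n) = zV)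
    (hzW' : dRec n ^ 3 * sharpNormaliser (bRecord' n) * coeffW (bRecord' n) = zW')
    (hzV' : dRec n ^ 6 * sharpNormaliser (bRecord' n) * coeffV (bRecord' n) = zV')
    (hzU : dRec n * sharpNormaliser (bRecord n) * coeffU (bRecord n) = zU)
    (hzU' : dRec n * sharpNormaliser (bRecord' n) * coeffU (bRecord' n) = zU') :
    (p : ℤ) ^ 3 ∣ (zW' * zV - zW * zV') ∧
    (p : ℤ) ^ 3 ∣ ((Nat.lcmUpto (41 * n) : ℤ) ^ 5 * (zU * zW') - (Nat.lcmUpto (41 * n) : ℤ) ^ 5 * (zU' * zW)) := by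
  have hloN : 15 * n < 1 * p := by
    have h : ((AZy 26 : ℕ) : ℝ) / 4680 * n < p := hlo
    rw [show AZy 26 = 70200 by decide] at h
    have h' : ((15 : ℕ) : ℝ) * n < ((1 : ℕ) : ℝ) * p := by push_cast at h ⊢; linarith
    exact_mod_cast h'
  have hhiN : 1 * p ≤ 16 * n := by
    have h : (p : ℝ) ≤ ((BZy 26 : ℕ) : ℝ) / 4680 * n := hhi
    rw [show BZy 26 = 74880 by decide] at h
    have h' : ((1 : ℕ) : ℝ) * p ≤ ((16 : ℕ) : ℝ) * n := by push_cast at h ⊢; linarith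
    exact_mod_cast h'
  exact wLaw3 hn hp (by omega) (by omega) hzW hzV hzW' hzV' hzU hzU'

end Windows

end Summit.KontsevichZagierPeriods.Zeta5Search.RecordRay
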